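import Summits.QuantumFields.YangMills.Theses.ComplexCouplingChannel
import Literature.MathematicalPhysics.QuantumFieldTheory.WilsonFinTorusPartitionComplex
import HarnessLib

/-!
# `ComplexCouplingChannel.FreeEnergyWindowChannel` — line Sketch, stub `stub_freeEnergyAnalytic`

Stub X4 (layer 5, a CALIBRATION consequence) of line `Sketch` for crux `FreeEnergyWindowChannel`
(item `stmt-QuantumFields-18842`, route `ComplexCouplingChannel` of `QuantumFields/YangMills`).

Under the crux, for every admissible `(G, r)` the bulk free-energy density of the symmetric torus,

  `F(β) = - lim_{P → ∞} P⁻⁴ log Z(β; P⁴)`,  `Z(β; P⁴) = wilsonFinTorusPartition r.ρ β P P P P`,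

EXISTS at every `β ≥ β₁` and is REAL-ANALYTIC on `[β₁, ∞)` (no bulk phase transition of any order at large
coupling).  Proof: take `β₁` from the crux and let `F t` be the limit of `-P⁻⁴ log Z(t; P⁴)` where it exists
(Mathlib's `limUnder`).  For `β ≥ β₁` the crux's window at `(β, ρ := 1)` gives an open `D ∋ β`, a holomorphic `f` on `D`
and `M, P₀` with `|log ‖Z_P z‖ + P⁴ Re f z| ≤ M` for `P ≥ P₀`, `z ∈ D`; at a REAL `t` with `(t : ℂ) ∈ D` the complex
partition function is the positive real one (`wilsonFinTorusPartitionC_ofReal`, `wilsonFinTorusPartition_pos`), so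
`|-P⁻⁴ log Z(t; P⁴) - Re f t| ≤ M P⁻⁴ → 0`, i.e. `F t = Re f t` on the open real neighbourhood
`{t | (t : ℂ) ∈ D}` of `β`; and `t ↦ Re f t` is real-analytic at `β` (`DifferentiableOn.analyticAt`,
`AnalyticAt.re_ofReal`), hence so is `F` (`AnalyticAt.congr`).  No anchor and no transport are needed.

Nothing here asserts a Theses statement; the file proves `crux → consequence` and supports the crux item.
-/

set_option autoImplicit false

noncomputable section

open Filter Topology
open Literature.MathematicalPhysics.QuantumFieldTheory

namespace Summit.QuantumFields.YangMills.Theorems.FreeEnergyWindowChannel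

/-- Calibration step: a uniform window bound `|a P + P⁴ c| ≤ M` for `P ≥ P₀` forces `-P⁻⁴ a P → c`
(indeed `|-P⁻⁴ a P - c| = P⁻⁴ |a P + P⁴ c| ≤ M P⁻⁴ → 0`). [folklore] -/
theorem tendsto_neg_inv_pow_four_mul_of_abs_add_le {a : ℕ → ℝ} {c M : ℝ} {P₀ : ℕ}
    (h : ∀ P : ℕ, P₀ ≤ P → |a P + (P : ℝ) ^ 4 * c| ≤ M) :
    Tendsto (fun P : ℕ => -(((P : ℝ) ^ 4)⁻¹ * a P)) atTop (𝓝 c) := by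
  have h4 : Tendsto (fun P : ℕ => ((P : ℝ) ^ 4)⁻¹) atTop (𝓝 0) :=
    tendsto_inv_atTop_zero.comp ((tendsto_pow_atTop four_ne_zero).comp tendsto_natCast_atTop_atTop)
  have hM : Tendsto (fun P : ℕ => M * ((P : ℝ) ^ 4)⁻¹) atTop (𝓝 0) := by
    simpa using h4.const_mul M
  rw [← tendsto_sub_nhds_zero_iff]
  refine squeeze_zero_norm' ?_ hM
  filter_upwards [eventually_ge_atTop (max P₀ 1)] with P hP
  have hP₀ : P₀ ≤ P := (le_max_left _ _).trans hP
  have hP1 : (0 : ℝ) < (P : ℝ) ^ 4 := by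
    have : (1 : ℝ) ≤ P := by exact_mod_cast (le_max_right _ _).trans hP
    positivity
  have hid : -(((P : ℝ) ^ 4)⁻¹ * a P) - c = -(((P : ℝ) ^ 4)⁻¹ * (a P + (P : ℝ) ^ 4 * c)) := by
    rw [mul_add, inv_mul_cancel_left₀ hP1.ne']
    ring
  rw [hid, Real.norm_eq_abs, abs_neg, abs_mul, abs_of_pos (inv_pos.2 hP1), mul_comm]
  exact mul_le_mul_of_nonneg_right (h P hP₀) (inv_pos.2 hP1).le

/-- STUB X4 of line `Sketch` (calibration consequence, layer 5).  Under `FreeEnergyWindowChannel`, for every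
admissible `(G, r)` there are `β₁` and a function `F : ℝ → ℝ`, real-analytic on a neighbourhood of every point of
`[β₁, ∞)`, with `-P⁻⁴ log Z(β; P⁴) → F β` for every `β ≥ β₁`: the bulk free-energy density exists and is
real-analytic at large coupling.  `F t` is the limit where it exists (`limUnder`); near `β ≥ β₁` the crux's window
at `(β, 1)` identifies it with `Re f` for the window's holomorphic `f`. [folklore] -/
theorem stub_freeEnergyAnalytic :
    Summit.QuantumFields.YangMills.Theses.ComplexCouplingChannel.FreeEnergyWindowChannel →
    ∀ (G : Type) [Group G] [TopologicalSpace G] [IsTopologicalGroup G] [CompactSpace G] [MeasurableSpace G] [BorelSpace G], Literature.MathematicalPhysics.QuantumFieldTheory.IsCompactSimpleLieGroup G → ∀ r : Literature.MathematicalPhysics.QuantumFieldTheory.LatticeRep G,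
      ∃ β₁ : ℝ, ∃ F : ℝ → ℝ, AnalyticOnNhd ℝ F (Set.Ici β₁) ∧ ∀ β : ℝ, β₁ ≤ β →
        Filter.Tendsto (fun P : ℕ => -(((P : ℝ) ^ 4)⁻¹ *
          Real.log (Literature.MathematicalPhysics.QuantumFieldTheory.wilsonFinTorusPartition r.ρ β P P P P)))
          Filter.atTop (nhds (F β)) := by
  intro h G _ _ _ _ _ _ hG r
  haveI : SecondCountableTopology G :=
    (r.continuous.isClosedEmbedding r.injective).isEmbedding.secondCountableTopology
  obtain ⟨β₁, hβ₁⟩ := h G hG r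
  -- the finite-volume free-energy densities and the candidate limit (`limUnder`: the limit where it exists)
  set u : ℝ → ℕ → ℝ := fun t P =>
    -(((P : ℝ) ^ 4)⁻¹ * Real.log (wilsonFinTorusPartition r.ρ t P P P P)) with hu
  let F : ℝ → ℝ := fun t => limUnder atTop (u t)
  have hF : ∀ (t L : ℝ), Tendsto (u t) atTop (𝓝 L) → F t = L := fun t L hL => hL.limUnder_eq
  -- near every `β ≥ β₁` the densities converge to a function real-analytic at `β`
  have key : ∀ β : ℝ, β₁ ≤ β → ∃ g : ℝ → ℝ, AnalyticAt ℝ g β ∧ ∀ᶠ t in 𝓝 β, Tendsto (u t) atTop (𝓝 (g t)) := by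
    intro β hβ
    obtain ⟨D, hDo, -, hβD, -, f, hf, M, P₀, hwin⟩ := hβ₁ β hβ 1 one_pos
    have hwin' : ∀ P : ℕ, P₀ ≤ P → ∀ z ∈ D, wilsonFinTorusPartitionC r.ρ z P P P P ≠ 0 ∧
        |Real.log ‖wilsonFinTorusPartitionC r.ρ z P P P P‖ + (P : ℝ) ^ 4 * (f z).re| ≤ M :=
      fun P hP z hz => hwin P hP z hz
    refine ⟨fun t => (f (t : ℂ)).re, (hf.analyticAt (hDo.mem_nhds hβD)).re_ofReal, ?_⟩
    have hU : {t : ℝ | (t : ℂ) ∈ D} ∈ 𝓝 β := (hDo.preimage Complex.continuous_ofReal).mem_nhds hβD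
    filter_upwards [hU] with t ht
    refine tendsto_neg_inv_pow_four_mul_of_abs_add_le (P₀ := P₀) (M := M) fun P hP => ?_
    have hnorm : ‖wilsonFinTorusPartitionC r.ρ (t : ℂ) P P P P‖ = wilsonFinTorusPartition r.ρ t P P P P := by
      rw [wilsonFinTorusPartitionC_ofReal, Complex.norm_real, Real.norm_eq_abs,
        abs_of_pos (wilsonFinTorusPartition_pos r.continuous t P P P P)]
    have := (hwin' P hP (t : ℂ) ht).2
    rwa [hnorm] at this
  refine ⟨β₁, F, fun β hβ => ?_, fun β hβ => ?_⟩
  · obtain ⟨g, hg, hev⟩ := key β hβ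
    refine hg.congr ?_
    filter_upwards [hev] with t ht
    exact (hF t _ ht).symm
  · obtain ⟨g, -, hev⟩ := key β hβ
    have hβ' : Tendsto (u β) atTop (𝓝 (g β)) := hev.self_of_nhds
    rw [hF β _ hβ']
    exact hβ'

end Summit.QuantumFields.YangMills.Theorems.FreeEnergyWindowChannel

end
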